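import Literature.Probability.RandomPlanarGeometry.SimpleCurves
import Literature.Probability.RandomPlanarGeometry.SimpleCurveLaws
import HarnessLib

/-!
# Shadowing lemma — stub `stub_shadowing` of the line `marked-point-revisit`
(crux `SAWLoopFugacityFlow.SimpleSubseqLimits`, stmt-CriticalPhenomena-4982)

The first of the two deterministic lemmas of the line: a NON-FLAT curve `γ` moving on the trace of
an injective curve `η` (same range, same starting point) *shadows* a non-degenerate sub-arc of `η`.

Proof. Let `f := η⁻¹ ∘ γ : I → I` (continuous: `η` is a homeomorphism onto its trace,
`Curve.IsSimple.homeomorphRange`), so `η (f r) = γ r` and `f 0 = 0`. If `f` were monotone, `γ = η ∘ f`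
would be flat; hence there are `u < v` with `f v < f u`. Put `t := v`, `y₁ := max_{[0, v]} f`,
`s :=` the least point of `[0, v]` where `f = y₁`, `y₀ := f v`. The clauses of `ShadowConfig` are
then elementary, the last one being two applications of the intermediate value theorem, on `[0, s]`
(where `f` climbs from `0` to `y₁`) and on `[s, v]` (where `f` descends from `y₁` to `y₀`).

The predicate `ShadowConfig` is a VERBATIM copy of the shared vocabulary of the line (the lead's
`Theorems/SAWLoopFugacityFlowMarkedPointRevisitDefs.lean`, namespace
`…Theorems.SimpleSubseqLimits.MarkedPointRevisit`, not yet in the tree when this file landed), kept in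
the sub-namespace `…MarkedPointRevisit.Shadowing` so that the two can never collide; the two
`ShadowConfig`s agree by `Iff.rfl`.
-/

noncomputable section

open MeasureTheory Filter Topology Set Metric
open Literature.Probability.RandomPlanarGeometry
open scoped ENNReal NNReal BoundedContinuousFunction unitInterval

namespace Summit.CriticalPhenomena.SAWScalingLimit.Theorems.SimpleSubseqLimits.MarkedPointRevisit.Shadowing

/-- **Shadowing configuration** of a curve `γ` against an injective curve `η`: at time `s` the curve
`γ` sits at the arc point `η y₁` for the FIRST time; up to the later time `t` it never passes beyond
level `y₁` of the arc; and every level `y ∈ [y₀, y₁)` (a non-degenerate sub-arc) is visited both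
before `s` and again in `(s, t]` — the sub-arc `η [y₀, y₁)` is *shadowed* (idea card
`marked-point-revisit`, lemma `Shadowing`). [folklore] -/
def ShadowConfig (η γ : Curve ℂ) (s t y₀ y₁ : I) : Prop :=
  s < t ∧ y₀ < y₁ ∧ γ s = η y₁ ∧ (∀ r : I, r < s → γ r ≠ η y₁) ∧
    (∀ r : I, r ≤ t → ∃ y : I, y ≤ y₁ ∧ γ r = η y) ∧
    ∀ y : I, y₀ ≤ y → y < y₁ →
      (∃ r : I, r < s ∧ γ r = η y) ∧ (∃ r' : I, s < r' ∧ r' ≤ t ∧ γ r' = η y)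

/-- **Arc coordinate of a curve moving on an arc.** If the trace of `γ` is the trace of an
injective curve `η` with the same starting point, then `γ = η ∘ f` for a continuous
`f : [0, 1] → [0, 1]` with `f 0 = 0` (`f = η⁻¹ ∘ γ`, `η` being a homeomorphism onto its trace by
compactness). [folklore] -/
theorem exists_arcCoordinate {η γ : Curve ℂ} (hη : η.IsSimple) (hr : Set.range γ = Set.range η)
    (h0 : γ 0 = η 0) :
    ∃ f : I → I, Continuous f ∧ f 0 = 0 ∧ ∀ r, η (f r) = γ r := by
  have hmem : ∀ r, γ r ∈ Set.range η := fun r => hr ▸ ⟨r, rfl⟩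
  let f : I → I := fun r => hη.homeomorphRange.symm ⟨γ r, hmem r⟩
  have hγc : Continuous fun r : I => (⟨γ r, hmem r⟩ : Set.range η) :=
    continuous_induced_rng.2 γ.continuous
  have hef : ∀ r, η (f r) = γ r := fun r => by
    have h := hη.coe_homeomorphRange_apply (hη.homeomorphRange.symm ⟨γ r, hmem r⟩)
    rw [Homeomorph.apply_symm_apply] at h
    exact h.symm
  exact ⟨f, hη.homeomorphRange.symm.continuous.comp hγc, hη (by rw [hef, h0]), hef⟩

/-- **A curve with a monotone arc coordinate is flat**: if `γ = η ∘ f` with `η` injective and `f`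
monotone, then `γ s = γ t`, `s ≤ u ≤ t`, forces `f s = f u = f t`, so `γ u = γ s`. [folklore] -/
theorem isFlat_of_monotone_arcCoordinate {η γ : Curve ℂ} (hη : η.IsSimple) {f : I → I}
    (hf : Monotone f) (hef : ∀ r, η (f r) = γ r) : γ.IsFlat := by
  intro s u t hsu hut hst
  have hfst : f s = f t := hη (by rw [hef, hef, hst])
  have hfu : f u = f s := le_antisymm (hfst ▸ hf hut) (hf hsu)
  rw [← hef u, hfu, hef]

/-- **Stub 1 of the line `marked-point-revisit` — SHADOWING.** A non-flat curve `γ` with the range of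
an injective curve `η` and the same starting point shadows a non-degenerate sub-arc: with
`f := η⁻¹ ∘ γ` (continuous, `f 0 = 0`, not monotone since `γ = η ∘ f` is not flat) pick `u < v` with
`f v < f u`, `y₁ := max_{[0,v]} f`, `s :=` the first time it is attained, `t := v`, `y₀ := f v`; two
applications of the intermediate value theorem. [folklore] -/
theorem stub_shadowing :
    ∀ (η γ : Curve ℂ), η.IsSimple → Set.range γ = Set.range η → γ 0 = η 0 → ¬ γ.IsFlat →
      ∃ s t y₀ y₁ : I, ShadowConfig η γ s t y₀ y₁ := by
  intro η γ hη hr h0 hflat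
  obtain ⟨f, hf, hf0, hef⟩ := exists_arcCoordinate hη hr h0
  -- `f` is not monotone: a dip `f v < f u` with `u < v`
  have hnm : ¬ Monotone f := fun hm => hflat (isFlat_of_monotone_arcCoordinate hη hm hef)
  obtain ⟨u, v, huv, hvu⟩ : ∃ u v : I, u ≤ v ∧ f v < f u := by
    by_contra h
    exact hnm fun a b hab => not_lt.1 fun hba => h ⟨a, b, hab, hba⟩
  have huv' : u < v := lt_of_le_of_ne huv (by rintro rfl; exact lt_irrefl _ hvu)
  -- `y₁ := f m`, the maximum of `f` on `[0, v]`
  have h0v : (0 : I) ≤ v := bot_le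
  obtain ⟨m, hmK, hmax⟩ :=
    (isCompact_Icc : IsCompact (Set.Icc (0 : I) v)).exists_isMaxOn ⟨v, h0v, le_rfl⟩
      hf.continuousOn
  -- `s :=` the least point of `[0, v]` where the maximum is attained
  have hS : IsCompact (Set.Icc (0 : I) v ∩ f ⁻¹' {f m}) :=
    (isClosed_Icc.inter (isClosed_singleton.preimage hf)).isCompact
  obtain ⟨s, ⟨hsK, hsy⟩, hsl⟩ := hS.exists_isLeast ⟨m, hmK, rfl⟩
  have hsy : f s = f m := hsy
  have hum : f u ≤ f m := hmax ⟨bot_le, huv⟩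
  have hvm : f v < f m := hvu.trans_le hum
  have hsv : s < v := by
    refine lt_of_le_of_ne hsK.2 ?_
    rintro rfl
    exact absurd hsy hvm.ne
  refine ⟨s, v, f v, f m, hsv, hvm, ?_, ?_, ?_, ?_⟩
  · -- `γ s = η y₁`
    rw [← hef, hsy]
  · -- before `s` the level `y₁` is not reached
    intro r hrs hr1
    have hfr : f r = f m := hη (by rw [hef, hr1])
    have hrS : r ∈ Set.Icc (0 : I) v ∩ f ⁻¹' {f m} := ⟨⟨bot_le, hrs.le.trans hsK.2⟩, hfr⟩
    exact absurd (hsl hrS) (not_le.2 hrs)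
  · -- up to `t = v` the curve stays below level `y₁`
    intro r hrv
    exact ⟨f r, hmax ⟨bot_le, hrv⟩, (hef r).symm⟩
  · -- every level in `[y₀, y₁)` is visited before `s` and again in `(s, v]`
    intro y hy0 hy1
    have hys : y ≠ f s := by rw [hsy]; exact hy1.ne
    constructor
    · have h0s : (0 : I) ≤ s := bot_le
      have hyI : y ∈ Set.Icc (f 0) (f s) := ⟨hf0.symm ▸ bot_le, hsy ▸ hy1.le⟩
      obtain ⟨r, hr, hry⟩ := intermediate_value_Icc h0s hf.continuousOn hyI
      have hrs : r ≠ s := by rintro rfl; exact hys hry.symm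
      exact ⟨r, lt_of_le_of_ne hr.2 hrs, by rw [← hef, hry]⟩
    · have hyI : y ∈ Set.Icc (f v) (f s) := ⟨hy0, hsy ▸ hy1.le⟩
      obtain ⟨r', hr', hry⟩ := intermediate_value_Icc' hsv.le hf.continuousOn hyI
      have hrs : r' ≠ s := by rintro rfl; exact hys hry.symm
      exact ⟨r', lt_of_le_of_ne hr'.1 (Ne.symm hrs), hr'.2, by rw [← hef, hry]⟩

end Summit.CriticalPhenomena.SAWScalingLimit.Theorems.SimpleSubseqLimits.MarkedPointRevisit.Shadowing

end
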